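import Mathlib
import Summits.CriticalPhenomena.PercolationContinuityZ3.Theorems.PercNearOneGluingNoHeavyLowerTailOrientedAntipodalHallOmegaSocket

/-!
# The cone-vector socket (CONJECTURE Σ ⇒ the oriented antipodal Hall count)

Helper file for crux `stmt-CriticalPhenomena-4575` (`NoHeavyLowerTail`, route `PercNearOneGluingNoHeavy`),
new-inequality factory seat `prim-ineq-gen-3` (gen 15).  Everything here is PROVED (a reduction).

Setting of `…OmegaSocket`: `f : Finset α → Lab k`, ground set `S`, `D` a family of subsets of `S`; `G` the
one-sided enlargement `{F ⊆ S : f F = B, f (S \ F) ≠ B, F ⊆ S \ X for some X ∈ D}`, `Ψ = {F ∈ G : f (S \ F) ≠ A}`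
the pseudo-sets, `K = {F ∈ G : f (S \ F) = A}` the co-goods above `D` (complements of the good sets above `D`),
`M = {S \ X : X ∈ D}` the complemented members.

**CONJECTURE Σ (cone vectors, gen 15).**  For a monotone labeling and an opposite-free family of antipodal bads,
the vectors `σ_U ∈ ℚ^K`, `σ_U(F) = #{Y ∈ {U} ∪ Ψ : F ⊆ Y ⊆ U}` (= the plain vector of the member PLUS the plain
vectors of all pseudo-sets below it, restricted to the co-goods), `U ∈ M`, are linearly independent.
It is the `t = 1` member of the family `χ_U + t·Σ_{E ∈ Ψ, E ⊆ U} χ_E`: `t = 0` is plain independence on the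
co-goods (false: 'invisible points'), `t = −1` fails exactly on the Ω-counterexamples, `t = 1` has 0 failures
in the EXHAUSTIVE five-point census of gen 15 (17.6 M (labeling, orientation, sub-family) runs) and in all
random tests (memo CONJECTURE-SIGMA.md in HOME `run/shared/lean/prim/prim-ineq-gen-3/`).

* `card_le_card_goods_above_of_indep_cogoods` — socket for ANY vector assignment `v : Finset α → ℚ^K`
  independent on `M`: then `#D ≤ #goods above D`.
* `card_le_card_goods_above_of_indep_cone`, `exists_injective_good_above_of_indep_cone` — CONJECTURE Σ
  (counting and SDR forms).
-/

namespace Summit.CriticalPhenomena.PercolationContinuityZ3.Theorems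

namespace OrientedAntipodalHall

open Finset Module AntipodalStrongHarris AntipodalStrongHarris.Lab ThreeFamilyRank
open scoped FinsetFamily

variable {α : Type*} [DecidableEq α] {k : ℕ}

/-- **Socket for vectors on the co-goods.**  If some assignment of vectors of `ℚ^K` (`K` = co-goods above `D`)
to the complemented members is linearly independent, then `#D ≤ #goods above D`. -/
theorem card_le_card_goods_above_of_indep_cogoods (S : Finset α) {f : Finset α → Lab k}
    (D G K M : Finset (Finset α)) (hDS : ∀ X ∈ D, X ⊆ S)
    (hG : G = {F ∈ S.powerset | f F = bot ∧ f (S \ F) ≠ bot ∧ ∃ X ∈ D, F ⊆ S \ X})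
    (hK : K = {F ∈ G | f (S \ F) = top}) (hM : M = D.image (fun X => S \ X)) (v : Finset α → Vec K)
    (hind : LinearIndependent ℚ fun U : ↥M => v (U : Finset α)) :
    #D ≤ #{U ∈ S.powerset | f U = top ∧ f (S \ U) = bot ∧ ∃ X ∈ D, X ⊆ U} := by
  classical
  have hMK : #M ≤ #K := by
    have h := hind.fintype_card_le_finrank
    rw [finrank_Vec, Fintype.card_coe] at h
    exact h
  have hinjD : Set.InjOn (fun X => S \ X) (D : Set (Finset α)) := by
    intro X₁ hX₁ X₂ hX₂ h
    have h₁ := Finset.sdiff_sdiff_eq_self (hDS X₁ hX₁)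
    have h₂ := Finset.sdiff_sdiff_eq_self (hDS X₂ hX₂)
    simp only at h
    rw [← h₁, ← h₂, h]
  have hcardM : #M = #D := by rw [hM]; exact card_image_of_injOn hinjD
  have hKS : ∀ F ∈ K, F ⊆ S := by
    intro F hF
    rw [hK, mem_filter, hG, mem_filter, mem_powerset] at hF
    exact hF.1.1
  have hinjK : Set.InjOn (fun F => S \ F) (K : Set (Finset α)) := by
    intro F₁ hF₁ F₂ hF₂ h
    have h₁ := Finset.sdiff_sdiff_eq_self (hKS F₁ hF₁)
    have h₂ := Finset.sdiff_sdiff_eq_self (hKS F₂ hF₂)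
    simp only at h
    rw [← h₁, ← h₂, h]
  have himg : K.image (fun F => S \ F) ⊆
      {U ∈ S.powerset | f U = top ∧ f (S \ U) = bot ∧ ∃ X ∈ D, X ⊆ U} := by
    intro U hU
    obtain ⟨F, hF, rfl⟩ := mem_image.mp hU
    have hFS := hKS F hF
    rw [hK, mem_filter, hG, mem_filter] at hF
    obtain ⟨⟨-, hFbot, -, X, hX, hFX⟩, hFtop⟩ := hF
    rw [mem_filter, mem_powerset, Finset.sdiff_sdiff_eq_self hFS]
    refine ⟨sdiff_subset, hFtop, hFbot, X, hX, ?_⟩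
    intro a ha
    exact mem_sdiff.mpr ⟨hDS X hX ha, fun haF => (mem_sdiff.mp (hFX haF)).2 ha⟩
  calc #D = #M := hcardM.symm
    _ ≤ #K := hMK
    _ = #(K.image fun F => S \ F) := (card_image_of_injOn hinjK).symm
    _ ≤ #{U ∈ S.powerset | f U = top ∧ f (S \ U) = bot ∧ ∃ X ∈ D, X ⊆ U} := card_le_card himg

/-- **Σ-socket, counting form.**  If the cone vectors `σ_U(F) = #{Y ∈ {U} ∪ Ψ : F ⊆ Y ⊆ U}` (`F ∈ K`) of the
complemented members are linearly independent in `ℚ^K`, then `#D ≤ #goods above D`. -/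
theorem card_le_card_goods_above_of_indep_cone (S : Finset α) {f : Finset α → Lab k}
    (D G Ψ K M : Finset (Finset α)) (hDS : ∀ X ∈ D, X ⊆ S)
    (hG : G = {F ∈ S.powerset | f F = bot ∧ f (S \ F) ≠ bot ∧ ∃ X ∈ D, F ⊆ S \ X})
    (_hΨ : Ψ = {F ∈ G | f (S \ F) ≠ top}) (hK : K = {F ∈ G | f (S \ F) = top})
    (hM : M = D.image (fun X => S \ X))
    (hind : LinearIndependent ℚ fun U : ↥M => fun F : ↥K =>
      (#{Y ∈ insert (U : Finset α) Ψ | (F : Finset α) ⊆ Y ∧ Y ⊆ (U : Finset α)} : ℚ)) :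
    #D ≤ #{U ∈ S.powerset | f U = top ∧ f (S \ U) = bot ∧ ∃ X ∈ D, X ⊆ U} :=
  card_le_card_goods_above_of_indep_cogoods S D G K M hDS hG hK hM
    (fun U => fun F : ↥K => (#{Y ∈ insert U Ψ | (F : Finset α) ⊆ Y ∧ Y ⊆ U} : ℚ)) hind

/-- **Σ-socket, SDR form.**  If CONJECTURE Σ holds for every sub-family of `D`, the members of `D` have
DISTINCT good representatives above them. -/
theorem exists_injective_good_above_of_indep_cone (S : Finset α) {f : Finset α → Lab k}
    (D : Finset (Finset α)) (hDS : ∀ X ∈ D, X ⊆ S)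
    (hind : ∀ D' ⊆ D, ∀ G Ψ K M : Finset (Finset α),
      G = {F ∈ S.powerset | f F = bot ∧ f (S \ F) ≠ bot ∧ ∃ X ∈ D', F ⊆ S \ X} →
      Ψ = {F ∈ G | f (S \ F) ≠ top} → K = {F ∈ G | f (S \ F) = top} → M = D'.image (fun X => S \ X) →
      LinearIndependent ℚ fun U : ↥M => fun F : ↥K =>
        (#{Y ∈ insert (U : Finset α) Ψ | (F : Finset α) ⊆ Y ∧ Y ⊆ (U : Finset α)} : ℚ)) :
    ∃ φ : D → Finset α, Function.Injective φ ∧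
      ∀ X : D, (X : Finset α) ⊆ φ X ∧ φ X ⊆ S ∧ f (φ X) = top ∧ f (S \ φ X) = bot := by
  classical
  let t : D → Finset (Finset α) := fun X =>
    {U ∈ S.powerset | f U = top ∧ f (S \ U) = bot ∧ (X : Finset α) ⊆ U}
  have hHall : ∀ s : Finset D, #s ≤ #(s.biUnion t) := by
    intro s
    set D' : Finset (Finset α) := s.map (Function.Embedding.subtype _) with hD'
    have hD'sub : D' ⊆ D := by
      intro X hX
      obtain ⟨x, -, rfl⟩ := mem_map.mp hX
      exact x.2
    have hcard : #s = #D' := (card_map _).symm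
    have hle := card_le_card_goods_above_of_indep_cone S D' _ _ _ _
      (fun X hX => hDS X (hD'sub hX)) rfl rfl rfl rfl (hind D' hD'sub _ _ _ _ rfl rfl rfl rfl)
    have hgoods : {U ∈ S.powerset | f U = top ∧ f (S \ U) = bot ∧ ∃ X ∈ D', X ⊆ U} ⊆
        s.biUnion t := by
      intro U hU
      rw [mem_filter, mem_powerset] at hU
      obtain ⟨hUS, hUtop, hUbot, X, hX, hXU⟩ := hU
      obtain ⟨x, hx, rfl⟩ := mem_map.mp hX
      rw [mem_biUnion]
      refine ⟨x, hx, ?_⟩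
      simp only [t, mem_filter, mem_powerset]
      exact ⟨hUS, hUtop, hUbot, hXU⟩
    calc #s = #D' := hcard
      _ ≤ #{U ∈ S.powerset | f U = top ∧ f (S \ U) = bot ∧ ∃ X ∈ D', X ⊆ U} := hle
      _ ≤ #(s.biUnion t) := card_le_card hgoods
  obtain ⟨φ, hφinj, hφ⟩ := (all_card_le_biUnion_card_iff_exists_injective t).mp hHall
  refine ⟨φ, hφinj, fun X => ?_⟩
  have hX := hφ X
  simp only [t, mem_filter, mem_powerset] at hX
  exact ⟨hX.2.2.2, hX.1, hX.2.1, hX.2.2.1⟩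

/-! ### Appendix (gen 15, later the same day): the top-count form — CONJECTURE Θ

CONJECTURE Θ: for a monotone labeling and an opposite-free family `D` of antipodal bads, the `D × N(D)` matrix
`θ(X, V) = #{Z : X ⊆ Z ⊆ V, f Z = A}` (top sets between the bad and the good) has full row rank; in co-good
coordinates `F = S \ V` its rows are the vectors `U ↦ (F ↦ #{W : F ⊆ W ⊆ U, f (S \ W) = A})` of the complemented
members.  Evidence: 0 failures in the exhaustive five-point census including all sub-families (17.6 M runs; memo
CONJECTURE-TWOSTEP.md), where the plain matrix `[X ⊆ V]` fails 49 680 times.  Proved there: Θ ⟺ the orthogonal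
projections of the member plain vectors onto `span{ζ_F : F ∈ Δ}` in `ℚ^{Θ* ∩ ↓M}` are independent; Θ for path-free
families.  The two declarations below are the instances of the general socket. -/

/-- **Θ-socket, counting form.**  If the top-count vectors `F ↦ #{W ⊆ S : F ⊆ W ⊆ U, f (S \ W) = A}` (`F ∈ K`) of
the complemented members `U` are linearly independent in `ℚ^K`, then `#D ≤ #goods above D`. -/
theorem card_le_card_goods_above_of_indep_top (S : Finset α) {f : Finset α → Lab k}
    (D G K M : Finset (Finset α)) (hDS : ∀ X ∈ D, X ⊆ S)
    (hG : G = {F ∈ S.powerset | f F = bot ∧ f (S \ F) ≠ bot ∧ ∃ X ∈ D, F ⊆ S \ X})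
    (hK : K = {F ∈ G | f (S \ F) = top}) (hM : M = D.image (fun X => S \ X))
    (hind : LinearIndependent ℚ fun U : ↥M => fun F : ↥K =>
      (#{W ∈ S.powerset | (F : Finset α) ⊆ W ∧ W ⊆ (U : Finset α) ∧ f (S \ W) = top} : ℚ)) :
    #D ≤ #{U ∈ S.powerset | f U = top ∧ f (S \ U) = bot ∧ ∃ X ∈ D, X ⊆ U} :=
  card_le_card_goods_above_of_indep_cogoods S D G K M hDS hG hK hM
    (fun U => fun F : ↥K => (#{W ∈ S.powerset | (F : Finset α) ⊆ W ∧ W ⊆ U ∧ f (S \ W) = top} : ℚ)) hind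

/-- **Θ-socket, SDR form.**  If CONJECTURE Θ holds for every sub-family of `D`, the members of `D` have DISTINCT good
representatives above them. -/
theorem exists_injective_good_above_of_indep_top (S : Finset α) {f : Finset α → Lab k}
    (D : Finset (Finset α)) (hDS : ∀ X ∈ D, X ⊆ S)
    (hind : ∀ D' ⊆ D, ∀ G K M : Finset (Finset α),
      G = {F ∈ S.powerset | f F = bot ∧ f (S \ F) ≠ bot ∧ ∃ X ∈ D', F ⊆ S \ X} →
      K = {F ∈ G | f (S \ F) = top} → M = D'.image (fun X => S \ X) →
      LinearIndependent ℚ fun U : ↥M => fun F : ↥K =>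
        (#{W ∈ S.powerset | (F : Finset α) ⊆ W ∧ W ⊆ (U : Finset α) ∧ f (S \ W) = top} : ℚ)) :
    ∃ φ : D → Finset α, Function.Injective φ ∧
      ∀ X : D, (X : Finset α) ⊆ φ X ∧ φ X ⊆ S ∧ f (φ X) = top ∧ f (S \ φ X) = bot := by
  classical
  let t : D → Finset (Finset α) := fun X =>
    {U ∈ S.powerset | f U = top ∧ f (S \ U) = bot ∧ (X : Finset α) ⊆ U}
  have hHall : ∀ s : Finset D, #s ≤ #(s.biUnion t) := by
    intro s
    set D' : Finset (Finset α) := s.map (Function.Embedding.subtype _) with hD'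
    have hD'sub : D' ⊆ D := by
      intro X hX
      obtain ⟨x, -, rfl⟩ := mem_map.mp hX
      exact x.2
    have hcard : #s = #D' := (card_map _).symm
    have hle := card_le_card_goods_above_of_indep_top S D' _ _ _
      (fun X hX => hDS X (hD'sub hX)) rfl rfl rfl (hind D' hD'sub _ _ _ rfl rfl rfl)
    have hgoods : {U ∈ S.powerset | f U = top ∧ f (S \ U) = bot ∧ ∃ X ∈ D', X ⊆ U} ⊆
        s.biUnion t := by
      intro U hU
      rw [mem_filter, mem_powerset] at hU
      obtain ⟨hUS, hUtop, hUbot, X, hX, hXU⟩ := hU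
      obtain ⟨x, hx, rfl⟩ := mem_map.mp hX
      rw [mem_biUnion]
      refine ⟨x, hx, ?_⟩
      simp only [t, mem_filter, mem_powerset]
      exact ⟨hUS, hUtop, hUbot, hXU⟩
    calc #s = #D' := hcard
      _ ≤ #{U ∈ S.powerset | f U = top ∧ f (S \ U) = bot ∧ ∃ X ∈ D', X ⊆ U} := hle
      _ ≤ #(s.biUnion t) := card_le_card hgoods
  obtain ⟨φ, hφinj, hφ⟩ := (all_card_le_biUnion_card_iff_exists_injective t).mp hHall
  refine ⟨φ, hφinj, fun X => ?_⟩
  have hX := hφ X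
  simp only [t, mem_filter, mem_powerset] at hX
  exact ⟨hX.2.2.2, hX.1, hX.2.1, hX.2.2.1⟩

end OrientedAntipodalHall

end Summit.CriticalPhenomena.PercolationContinuityZ3.Theorems
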